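import Summits.QuantumFields.YangMills.Theorems.BalabanUVNodesN15KingModelProp37AtRegularFieldEntryHolder

/-!
# N15 (NE2⁺, row s3 KING-MODEL ∕ RIEMANN-KERNEL RUNG) — PART Ζ-h₂: THE ENTRYWISE HÖLDER LINES (3.65)₁,₂ AT A REGULAR BACKGROUND IN KING's GAUGE,
# ALL PAIRS — from [Ba3] (2.10)∕(2.11) (lit-balaban p26) and PART Ζ-h₁'s entrywise step∕chain letters

count-neutral helper of the pub-ymgap K3⁸ programme (`--supports stmt-QuantumFields-27366`); nothing here is a claim about Bałaban's
non-abelian `G(U)`, the continuum, ℝ⁴, OS axioms, a mass gap or the Clay problem.  One finite torus `T_ε` at fixed `ε`.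

[King1986] Prop. 3.7 (3.62)∕(3.65) p. 663; the gauge of p. 661 (3.43)–(3.46), *"|Ã^{(k)}(x)| ≤ Cp(L^kε)|x − x₀|. (3.45)"*; p. 665 «also holds for G_(j)(□′, Ã^{(k)})».
[Balaban1983Higgs3] (2.10)–(2.11) p. 426 — the HYPOTHESES `Ineq210 δ C` ∕ `Ineq211At α δ C` on p26's carriers below.

## What this file proves (0 `def`, 0 `sorry`)

Under `|A_b| ≤ A_∞` on all bonds and `d·|e|·A_∞·(L^kε) ≤ 1` (King's re-gauged regime), for the ENTRIES `G_(j)(x,z)_{ii′}`, `(D_{A,μ}G_(j))(x,z)_{ii′}` of PART Ζ-h₁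
and slices `j + 1 ≤ k`:
* §1 ★ `entG_holder_near` (pairs `ε|x−y| ≤ L^jε`: (2.10) chained along p26's admissible staircase with the transport defect absorbed, constant
  `3d·C·e^{δ(d+1)}`; far pairs: Ζ-h₁ `entG_holder_far`), ★★ **`entG_holder_le`** — (3.65)₁ ENTRYWISE, all pairs:
  `|G_(j)(x,z)_{ii′} − G_(j)(y,z)_{ii′}| ≤ (3d·e^{δ(d+1)} + 2)·C·(ε|x−y|)^α(L^jε)^{2−d−α}e^{−δ(L^jε)^{−1}dist({x,y},z)}`.
* §2 ★★ **`entDG_holder_le`** — (3.65)₂ ENTRYWISE, all pairs: the transported term is (2.11) (p26 `holderTerm_le_holderDiff`), the defect of the transport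
  along the staircase `‖U(A(Γ)) − 1‖ ≤ |Γ|·2ε|e|A_∞` (Ζ-h₁ `norm_hol_apply_sub_self_le`) is absorbed for near pairs, far pairs by sizes; constant `3·C`
  (with `C` common to `Ineq210` and `Ineq211At`, as in p26's `ineq210_and_211At_regularTorusH`).

HONEST SCOPE.  As PART Ζ-h₁: the sup-norm gauge hypothesis is explicit and NOT implied by regularity; `Ω = T_ε`; more than two sites per direction
(`2 < |T_ε|_μ`, automatic on the rung's tori) for the pair form of the bond variables.  Unit `pub-ymgap-dag-n15-e` g22 (R141 (C) s3), PART Ζ-h₂.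
-/

noncomputable section

open scoped BigOperators

namespace Summit.QuantumFields.YangMills.BalabanUVNodes.N15KingModelRung.RegularField

open Literature.MathematicalPhysics.QuantumFieldTheory.Balaban1983to89
open Literature.MathematicalPhysics.QuantumFieldTheory.Balaban1983to89.HiggsLattice (ChargeData ScalarField covDeriv)
open Literature.MathematicalPhysics.QuantumFieldTheory.Balaban1983to89.HiggsCovariance (E)
open Literature.MathematicalPhysics.QuantumFieldTheory.Balaban1983to89.B1Eq221Coordinates (fieldCoord)
open Literature.MathematicalPhysics.QuantumFieldTheory.Balaban1983to89.B1Eq230FluctCov (Ix cb)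
open Literature.MathematicalPhysics.QuantumFieldTheory.Balaban1983to89.B1Ineq227BackgroundTorus (abs_fieldCoord_le)
open Literature.MathematicalPhysics.QuantumFieldTheory.Balaban1983to89.B1Ineq234LevelZero (tdist_comm tdist_triangle_real tdist_shift_le_one)
open Literature.MathematicalPhysics.QuantumFieldTheory.Balaban1983to89.B1TorusChainTransport (IsTChain TNbr hol norm_hol_apply tdist_mem_chain_le)
open Literature.MathematicalPhysics.QuantumFieldTheory.Balaban1983to89.B4GaugeCovariance (pathEnd)
open Literature.MathematicalPhysics.QuantumFieldTheory.Balaban1983to89.B3Sect2StatementsPart2 (ScaledKernels)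
open Literature.MathematicalPhysics.QuantumFieldTheory.Balaban1983to89.B1Eq211ZeroFieldTorus (Shape)
open Literature.MathematicalPhysics.QuantumFieldTheory.Balaban1983to89.B3Ineq210RegularTorus (pieceA regTorusKernels regTorusKernels_absG
  regTorusKernels_absDG regTorusKernels_dist scale_eq mesh_eq_pow_mul mesh_mono)
open Literature.MathematicalPhysics.QuantumFieldTheory.Balaban1983to89.B3Ineq211RegularTorus (IsAdm exists_isAdm one_le_tdist_of_ne' holderTerm
  holderTerm_le_holderDiff regTorusKernelsH scaleH_eq)

variable {P : HiggsLattice.Params} {N : ℕ}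

section Torus

variable {S : Shape P} {C : ChargeData N} {A : HiggsLattice.VecField P 0} {msq a : ℝ} {k : ℕ}

/-- exponential weights with a shifted argument. [folklore] -/
private theorem exp_neg_mul_sub₂ (ρ t u : ℝ) : Real.exp (-(ρ * (t - u))) = Real.exp (-(ρ * t)) * Real.exp (ρ * u) := by
  rw [← Real.exp_add]; congr 1; ring

/-! ## §1 (3.65)₁ entrywise -/

/-- ★ **(3.65)₁ ENTRYWISE FOR NEAR PAIRS** (`ε|x − y| ≤ L^jε`, `j + 1 ≤ k`), in King's gauge. [cite: King1986, Prop 3.7 (3.65) p.663, (3.45) p.661] [cite: Balaban1983Higgs3, (2.10) p.426] -/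
theorem entG_holder_near {δ Cst : ℝ} (hδ : 0 ≤ δ) (hCst : 0 ≤ Cst) (h210 : (regTorusKernels S C A msq a k).Ineq210 δ Cst)
    {Asup : ℝ} (hA : ∀ b, |A b| ≤ Asup) (hgauge : (P.d : ℝ) * |C.e| * Asup * P.mesh k ≤ 1)
    {α : ℝ} (hα1 : α ≤ 1) {j : ℕ} (hjk : j + 1 ≤ k) (i i' : Ix N) {x y : HiggsLattice.Site P 0} (hxy : x ≠ y)
    (hnear : P.mesh 0 * (HiggsLattice.Site.tdist x y : ℝ) ≤ P.mesh j) (z : HiggsLattice.Site P 0) :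
    |entG C A msq a k j i i' x z - entG C A msq a k j i i' y z|
      ≤ 3 * (P.d : ℝ) * Cst * Real.exp (δ * (P.d + 1)) * (P.mesh 0 * (HiggsLattice.Site.tdist x y : ℝ)) ^ α
          * P.mesh j ^ ((2 : ℝ) - (P.d : ℝ) - α)
          * Real.exp (-(δ * (P.mesh j)⁻¹ * (P.mesh 0 * min (HiggsLattice.Site.tdist x z : ℝ) (HiggsLattice.Site.tdist y z : ℝ)))) := by
  have hε : 0 < P.mesh 0 := P.mesh_pos 0
  have hs : 0 < P.mesh j := P.mesh_pos j
  have hd1 : (1 : ℝ) ≤ P.d := by exact_mod_cast P.hd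
  have hAsup0 : 0 ≤ Asup := (abs_nonneg _).trans (hA ⟨x, ⟨0, P.hd⟩⟩)
  have hεs : P.mesh 0 ≤ P.mesh j := by simpa using mesh_mono P (Nat.zero_le j)
  have hsk : P.mesh j ≤ P.mesh k := mesh_mono P (by omega)
  -- the gauge smallness at scale `ε` and at scale `L^jε`
  have heA : |C.e| * Asup * P.mesh j ≤ 1 := by
    have h1 : |C.e| * Asup * P.mesh j ≤ (P.d : ℝ) * |C.e| * Asup * P.mesh k := by
      have h0 : 0 ≤ |C.e| * Asup := mul_nonneg (abs_nonneg _) hAsup0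
      calc |C.e| * Asup * P.mesh j ≤ |C.e| * Asup * P.mesh k := mul_le_mul_of_nonneg_left hsk h0
        _ = 1 * (|C.e| * Asup * P.mesh k) := (one_mul _).symm
        _ ≤ (P.d : ℝ) * (|C.e| * Asup * P.mesh k) := mul_le_mul_of_nonneg_right hd1 (mul_nonneg h0 (P.mesh_pos k).le)
        _ = (P.d : ℝ) * |C.e| * Asup * P.mesh k := by ring
    exact h1.trans hgauge
  have hsmall : P.mesh 0 * |C.e| * Asup ≤ 1 := by
    calc P.mesh 0 * |C.e| * Asup = |C.e| * Asup * P.mesh 0 := by ring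
      _ ≤ |C.e| * Asup * P.mesh j := mul_le_mul_of_nonneg_left hεs (mul_nonneg (abs_nonneg _) hAsup0)
      _ ≤ 1 := heA
  obtain ⟨Γ, hch, hend, hlen⟩ := exists_isAdm y x
  set r : ℝ := P.mesh 0 * (HiggsLattice.Site.tdist x y : ℝ) with hr
  have hr0 : 0 < r := by
    have h1 : (1 : ℝ) ≤ HiggsLattice.Site.tdist x y := by exact_mod_cast one_le_tdist_of_ne' (Ne.symm hxy)
    rw [hr]; positivity
  have htxy : (HiggsLattice.Site.tdist y x : ℝ) = HiggsLattice.Site.tdist x y := by rw [tdist_comm]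
  set Emin : ℝ := Real.exp (-(δ * (P.mesh j)⁻¹ * (P.mesh 0 * min (HiggsLattice.Site.tdist x z : ℝ) (HiggsLattice.Site.tdist y z : ℝ))))
    with hEmin
  set B : ℝ := Emin * Real.exp (δ * (P.d + 1)) with hB
  set M : ℝ := P.mesh 0 * (Cst * P.mesh j ^ ((1 : ℝ) - (P.d : ℝ)) * B)
    + 2 * (P.mesh 0 * |C.e| * Asup) * (Cst * P.mesh j ^ ((2 : ℝ) - (P.d : ℝ)) * B) with hM
  -- the weight at a site within `|Γ| + 1` of `y`
  have hweight : ∀ w : HiggsLattice.Site P 0, (HiggsLattice.Site.tdist y w : ℝ) ≤ Γ.length + 1 →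
      Real.exp (-(δ * (P.mesh j)⁻¹ * (P.mesh 0 * (HiggsLattice.Site.tdist w z : ℝ)))) ≤ B := by
    intro w hyw
    have hlen' : (Γ.length : ℝ) ≤ (P.d : ℝ) * HiggsLattice.Site.tdist x y := by rw [← htxy]; exact hlen
    have htri : (HiggsLattice.Site.tdist y z : ℝ) ≤ HiggsLattice.Site.tdist y w + HiggsLattice.Site.tdist w z := tdist_triangle_real y w z
    have hmin : min (HiggsLattice.Site.tdist x z : ℝ) (HiggsLattice.Site.tdist y z : ℝ) ≤ HiggsLattice.Site.tdist y z := min_le_right _ _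
    have hwz : min (HiggsLattice.Site.tdist x z : ℝ) (HiggsLattice.Site.tdist y z : ℝ) - ((P.d : ℝ) * HiggsLattice.Site.tdist x y + 1)
        ≤ (HiggsLattice.Site.tdist w z : ℝ) := by linarith
    have hρ : 0 ≤ δ * (P.mesh j)⁻¹ * P.mesh 0 := by positivity
    calc Real.exp (-(δ * (P.mesh j)⁻¹ * (P.mesh 0 * (HiggsLattice.Site.tdist w z : ℝ))))
        ≤ Real.exp (-(δ * (P.mesh j)⁻¹ * (P.mesh 0 *
            (min (HiggsLattice.Site.tdist x z : ℝ) (HiggsLattice.Site.tdist y z : ℝ) - ((P.d : ℝ) * HiggsLattice.Site.tdist x y + 1))))) := by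
          rw [Real.exp_le_exp, neg_le_neg_iff, ← mul_assoc, ← mul_assoc]
          exact mul_le_mul_of_nonneg_left hwz hρ
      _ = Emin * Real.exp (δ * (P.mesh j)⁻¹ * ((P.d : ℝ) * r + P.mesh 0)) := by
          rw [hEmin, hr, mul_sub, ← exp_neg_mul_sub₂]; congr 1; ring
      _ ≤ B := by
          rw [hB]
          refine mul_le_mul_of_nonneg_left (Real.exp_le_exp.2 ?_) (Real.exp_nonneg _)
          have h1 : (P.mesh j)⁻¹ * r ≤ 1 := by rw [inv_mul_le_iff₀ hs]; simpa [hr] using hnear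
          have h2 : (P.mesh j)⁻¹ * P.mesh 0 ≤ 1 := by rw [inv_mul_le_iff₀ hs]; simpa using hεs
          have hd0 : (0 : ℝ) ≤ P.d := Nat.cast_nonneg _
          calc δ * (P.mesh j)⁻¹ * ((P.d : ℝ) * r + P.mesh 0) = δ * (P.d * ((P.mesh j)⁻¹ * r) + (P.mesh j)⁻¹ * P.mesh 0) := by ring
            _ ≤ δ * (P.d * 1 + 1) := mul_le_mul_of_nonneg_left (add_le_add (mul_le_mul_of_nonneg_left h1 hd0) h2) hδ
            _ = δ * (P.d + 1) := by ring
  have hchain : ∀ w ∈ y :: Γ, ∀ μ : Fin P.d, P.mesh 0 * (regTorusKernels S C A msq a k).absDG j μ w z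
      + 2 * (P.mesh 0 * |C.e| * Asup) * (regTorusKernels S C A msq a k).absG j (w.shift μ) z ≤ M := by
    intro w hw μ
    have hbD := (h210 j w z).2 μ
    have hbG := (h210 j (w.shift μ) z).1
    rw [scale_eq, regTorusKernels_dist] at hbD hbG
    have hyw : (HiggsLattice.Site.tdist y w : ℝ) ≤ Γ.length := tdist_mem_chain_le hch w hw
    have hyw' : (HiggsLattice.Site.tdist y (w.shift μ) : ℝ) ≤ Γ.length + 1 := by
      have h1 := tdist_triangle_real y w (w.shift μ)
      have h2 : (HiggsLattice.Site.tdist w (w.shift μ) : ℝ) ≤ 1 := by exact_mod_cast tdist_shift_le_one w μ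
      linarith
    have hW1 := hweight w (by linarith)
    have hW2 := hweight (w.shift μ) hyw'
    rw [hM]
    refine add_le_add ?_ ?_
    · exact mul_le_mul_of_nonneg_left (hbD.trans (mul_le_mul_of_nonneg_left hW1 (by positivity))) hε.le
    · exact mul_le_mul_of_nonneg_left (hbG.trans (mul_le_mul_of_nonneg_left hW2 (by positivity))) (by positivity)
  have hmain := entG_chain_le' (S := S) (C := C) (A := A) (msq := msq) (a := a) (k := k) j i i' z hA hsmall y Γ hch hend hchain
  -- `M ≤ 3·ε·Cst·s^{1−d}·B` (gauge smallness at scale `L^jε`), then as in PART Ζ-a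
  have hM0 : 0 ≤ M := by rw [hM]; positivity
  have hMle : M ≤ 3 * (P.mesh 0 * (Cst * P.mesh j ^ ((1 : ℝ) - (P.d : ℝ)) * B)) := by
    have hkey : 2 * (P.mesh 0 * |C.e| * Asup) * (Cst * P.mesh j ^ ((2 : ℝ) - (P.d : ℝ)) * B)
        ≤ 2 * (P.mesh 0 * (Cst * P.mesh j ^ ((1 : ℝ) - (P.d : ℝ)) * B)) := by
      have hsplit' : P.mesh j ^ ((2 : ℝ) - (P.d : ℝ)) = P.mesh j ^ (1 : ℝ) * P.mesh j ^ ((1 : ℝ) - (P.d : ℝ)) := by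
        rw [← Real.rpow_add hs]; congr 1; ring
      rw [Real.rpow_one] at hsplit'
      rw [hsplit']
      have hnn : 0 ≤ P.mesh 0 * (Cst * P.mesh j ^ ((1 : ℝ) - (P.d : ℝ)) * B) := by positivity
      calc 2 * (P.mesh 0 * |C.e| * Asup) * (Cst * (P.mesh j * P.mesh j ^ ((1 : ℝ) - (P.d : ℝ))) * B)
          = 2 * (|C.e| * Asup * P.mesh j) * (P.mesh 0 * (Cst * P.mesh j ^ ((1 : ℝ) - (P.d : ℝ)) * B)) := by ring
        _ ≤ 2 * 1 * (P.mesh 0 * (Cst * P.mesh j ^ ((1 : ℝ) - (P.d : ℝ)) * B)) :=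
            mul_le_mul_of_nonneg_right (mul_le_mul_of_nonneg_left heA (by norm_num)) hnn
        _ = 2 * (P.mesh 0 * (Cst * P.mesh j ^ ((1 : ℝ) - (P.d : ℝ)) * B)) := by ring
    rw [hM]; linarith
  have hlen' : (Γ.length : ℝ) ≤ (P.d : ℝ) * HiggsLattice.Site.tdist x y := by rw [← htxy]; exact hlen
  have h3 : 0 ≤ 3 * (P.mesh 0 * (Cst * P.mesh j ^ ((1 : ℝ) - (P.d : ℝ)) * B)) := by positivity
  refine hmain.trans ((mul_le_mul hlen' hMle hM0 (by positivity)).trans ?_)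
  have hkey : r * P.mesh j ^ ((1 : ℝ) - (P.d : ℝ)) ≤ r ^ α * P.mesh j ^ ((2 : ℝ) - (P.d : ℝ) - α) := by
    have hrle : r ≤ P.mesh j := by simpa [hr] using hnear
    have h1 : r = r ^ α * r ^ (1 - α) := by rw [← Real.rpow_add hr0]; norm_num
    have h2 : r ^ (1 - α) ≤ P.mesh j ^ (1 - α) := Real.rpow_le_rpow hr0.le hrle (by linarith)
    have h3' : P.mesh j ^ (1 - α) * P.mesh j ^ ((1 : ℝ) - (P.d : ℝ)) = P.mesh j ^ ((2 : ℝ) - (P.d : ℝ) - α) := by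
      rw [← Real.rpow_add hs]; congr 1; ring
    calc r * P.mesh j ^ ((1 : ℝ) - (P.d : ℝ)) = r ^ α * (r ^ (1 - α) * P.mesh j ^ ((1 : ℝ) - (P.d : ℝ))) := by rw [← mul_assoc, ← h1]
      _ ≤ r ^ α * (P.mesh j ^ (1 - α) * P.mesh j ^ ((1 : ℝ) - (P.d : ℝ))) :=
          mul_le_mul_of_nonneg_left (mul_le_mul_of_nonneg_right h2 (Real.rpow_nonneg hs.le _)) (Real.rpow_nonneg hr0.le _)
      _ = r ^ α * P.mesh j ^ ((2 : ℝ) - (P.d : ℝ) - α) := by rw [h3']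
  calc (P.d : ℝ) * (HiggsLattice.Site.tdist x y : ℝ) * (3 * (P.mesh 0 * (Cst * P.mesh j ^ ((1 : ℝ) - (P.d : ℝ)) * B)))
      = 3 * (P.d : ℝ) * Cst * Real.exp (δ * (P.d + 1)) * (r * P.mesh j ^ ((1 : ℝ) - (P.d : ℝ))) * Emin := by rw [hB, hr]; ring
    _ ≤ 3 * (P.d : ℝ) * Cst * Real.exp (δ * (P.d + 1)) * (r ^ α * P.mesh j ^ ((2 : ℝ) - (P.d : ℝ) - α)) * Emin :=
        mul_le_mul_of_nonneg_right (mul_le_mul_of_nonneg_left hkey (by positivity)) (Real.exp_nonneg _)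
    _ = _ := by ring

/-- ★★ **(3.65)₁ ENTRYWISE, ALL PAIRS `x ≠ y`, SLICES `j + 1 ≤ k`, IN KING's GAUGE** (`|A_b| ≤ A_∞`, `d|e|A_∞L^kε ≤ 1`; under (2.10) at `(δ, Cst)`):
`|G_(j)(x,z)_{ii′} − G_(j)(y,z)_{ii′}| ≤ (3d·e^{δ(d+1)} + 2)·Cst·(ε|x−y|)^α(L^jε)^{2−d−α}e^{−δ(L^jε)^{−1}dist({x,y},z)}` — King's transport-free (3.62)∕(3.65)₁ for the matrix
entries. [cite: King1986, Prop 3.7 (3.62), (3.65) p.663, (3.45)–(3.46) p.661, p.665] [cite: Balaban1983Higgs3, (2.10) p.426] -/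
theorem entG_holder_le {δ Cst : ℝ} (hδ : 0 ≤ δ) (hCst : 0 ≤ Cst) (h210 : (regTorusKernels S C A msq a k).Ineq210 δ Cst)
    {Asup : ℝ} (hA : ∀ b, |A b| ≤ Asup) (hgauge : (P.d : ℝ) * |C.e| * Asup * P.mesh k ≤ 1)
    {α : ℝ} (hα0 : 0 ≤ α) (hα1 : α ≤ 1) {j : ℕ} (hjk : j + 1 ≤ k) (i i' : Ix N) {x y : HiggsLattice.Site P 0} (hxy : x ≠ y)
    (z : HiggsLattice.Site P 0) :
    |entG C A msq a k j i i' x z - entG C A msq a k j i i' y z|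
      ≤ (3 * (P.d : ℝ) * Real.exp (δ * (P.d + 1)) + 2) * Cst * (P.mesh 0 * (HiggsLattice.Site.tdist x y : ℝ)) ^ α
          * P.mesh j ^ ((2 : ℝ) - (P.d : ℝ) - α)
          * Real.exp (-(δ * (P.mesh j)⁻¹ * (P.mesh 0 * min (HiggsLattice.Site.tdist x z : ℝ) (HiggsLattice.Site.tdist y z : ℝ)))) := by
  set W : ℝ := (P.mesh 0 * (HiggsLattice.Site.tdist x y : ℝ)) ^ α * P.mesh j ^ ((2 : ℝ) - (P.d : ℝ) - α)
      * Real.exp (-(δ * (P.mesh j)⁻¹ * (P.mesh 0 * min (HiggsLattice.Site.tdist x z : ℝ) (HiggsLattice.Site.tdist y z : ℝ)))) with hW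
  have hW0 : 0 ≤ W := by
    rw [hW]
    exact mul_nonneg (mul_nonneg (Real.rpow_nonneg (mul_nonneg (P.mesh_pos 0).le (Nat.cast_nonneg _)) _)
      (Real.rpow_nonneg (P.mesh_pos j).le _)) (Real.exp_nonneg _)
  have hgoal : (3 * (P.d : ℝ) * Real.exp (δ * (P.d + 1)) + 2) * Cst * (P.mesh 0 * (HiggsLattice.Site.tdist x y : ℝ)) ^ α
        * P.mesh j ^ ((2 : ℝ) - (P.d : ℝ) - α)
        * Real.exp (-(δ * (P.mesh j)⁻¹ * (P.mesh 0 * min (HiggsLattice.Site.tdist x z : ℝ) (HiggsLattice.Site.tdist y z : ℝ))))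
      = 3 * (P.d : ℝ) * Cst * Real.exp (δ * (P.d + 1)) * W + 2 * Cst * W := by rw [hW]; ring
  rw [hgoal]
  rcases le_total (P.mesh 0 * (HiggsLattice.Site.tdist x y : ℝ)) (P.mesh j) with hnear | hfar
  · have h := entG_holder_near hδ hCst h210 hA hgauge hα1 hjk i i' hxy hnear z
    have h' : |entG C A msq a k j i i' x z - entG C A msq a k j i i' y z| ≤ 3 * (P.d : ℝ) * Cst * Real.exp (δ * (P.d + 1)) * W := by
      rw [hW]; simpa [mul_assoc] using h
    exact h'.trans (le_add_of_nonneg_right (by positivity))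
  · have h := entG_holder_far (S := S) hδ hCst h210 hα0 j i i' hfar z
    have h' : |entG C A msq a k j i i' x z - entG C A msq a k j i i' y z| ≤ 2 * Cst * W := by
      rw [hW]; simpa [mul_assoc] using h
    exact h'.trans (le_add_of_nonneg_left (by positivity))

/-! ## §2 (3.65)₂ entrywise -/

/-- the entry difference of the derivative is below the transported term plus the transport defect:
`|(DG)(x,z)_{ii′} − (DG)(y,z)_{ii′}| ≤ holderTerm(Γ) + ε^{−d}‖(U(A(Γ)) − 1)(DGe_{(z,i′)})(x)‖` for every list `Γ` (p26's `holderTerm` transports along `(y, Γ)`).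
[cite: King1986, (3.62) p.663] [cite: Balaban1983Higgs3, (2.11) p.426] -/
theorem abs_entDG_sub_le (j : ℕ) (μ : Fin P.d) (i i' : Ix N) (x y z : HiggsLattice.Site P 0) (Γ : List (HiggsLattice.Site P 0)) :
    |entDG C A msq a k j μ i i' x z - entDG C A msq a k j μ i i' y z|
      ≤ holderTerm C A msq a k j μ y x z Γ
        + (P.mesh 0 ^ P.d)⁻¹ * ‖hol C A y Γ (covDeriv C A (pieceA C A msq a k j (cb P N 0 (z, i'))) ⟨x, μ⟩)
            - covDeriv C A (pieceA C A msq a k j (cb P N 0 (z, i'))) ⟨x, μ⟩‖ := by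
  set φ := pieceA C A msq a k j (cb P N 0 (z, i')) with hφ
  set ψ : ScalarField P 0 N := fun w => covDeriv C A φ ⟨w, μ⟩ with hψ
  have hεd : 0 ≤ (P.mesh 0 ^ P.d)⁻¹ := inv_nonneg.2 (pow_nonneg (P.mesh_pos 0).le _)
  have hdiff : entDG C A msq a k j μ i i' x z - entDG C A msq a k j μ i i' y z
      = (P.mesh 0 ^ P.d)⁻¹ * fieldCoord (E N) (HiggsLattice.Site P 0) (fun w => ψ x - ψ y) (x, i) := by
    rw [entDG, entDG, ← mul_sub]
    congr 1
    have : (fun w : HiggsLattice.Site P 0 => ψ x - ψ y) = (fun _ => ψ x) - (fun _ => ψ y) := rfl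
    rw [this, map_sub]
    rfl
  rw [hdiff, abs_mul, abs_of_nonneg hεd]
  have hcoord := abs_fieldCoord_le (fun w : HiggsLattice.Site P 0 => ψ x - ψ y) x i
  have hsplit : ‖ψ x - ψ y‖ ≤ ‖hol C A y Γ (ψ x) - ψ y‖ + ‖hol C A y Γ (ψ x) - ψ x‖ := by
    have : ψ x - ψ y = (hol C A y Γ (ψ x) - ψ y) - (hol C A y Γ (ψ x) - ψ x) := by abel
    rw [this]; exact norm_sub_le _ _
  have hterm : (P.mesh 0 ^ P.d)⁻¹ * ‖hol C A y Γ (ψ x) - ψ y‖ ≤ holderTerm C A msq a k j μ y x z Γ := by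
    rw [holderTerm]
    refine mul_le_mul_of_nonneg_left ?_ hεd
    exact Finset.single_le_sum (f := fun i'' : Ix N =>
      ‖hol C A y Γ (covDeriv C A (pieceA C A msq a k j (cb P N 0 (z, i''))) ⟨x, μ⟩) - covDeriv C A (pieceA C A msq a k j (cb P N 0 (z, i''))) ⟨y, μ⟩‖)
      (fun _ _ => norm_nonneg _) (Finset.mem_univ i')
  calc (P.mesh 0 ^ P.d)⁻¹ * |fieldCoord (E N) (HiggsLattice.Site P 0) (fun w => ψ x - ψ y) (x, i)|
      ≤ (P.mesh 0 ^ P.d)⁻¹ * (‖hol C A y Γ (ψ x) - ψ y‖ + ‖hol C A y Γ (ψ x) - ψ x‖) :=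
        mul_le_mul_of_nonneg_left (hcoord.trans hsplit) hεd
    _ = (P.mesh 0 ^ P.d)⁻¹ * ‖hol C A y Γ (ψ x) - ψ y‖ + (P.mesh 0 ^ P.d)⁻¹ * ‖hol C A y Γ (ψ x) - ψ x‖ := by ring
    _ ≤ _ := add_le_add hterm le_rfl

/-- ★★ **(3.65)₂ ENTRYWISE, ALL PAIRS `x ≠ y`, SLICES `j + 1 ≤ k`, IN KING's GAUGE**: under (2.10) at `(δ, Cst)` and (2.11) at `(α, δ, Cst)` for p26's Hölder carrier,
`|A_b| ≤ A_∞`, `d|e|A_∞L^kε ≤ 1`, and more than two sites per direction: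
`|(D_{A,μ}G_(j))(x,z)_{ii′} − (D_{A,μ}G_(j))(y,z)_{ii′}| ≤ 3·Cst·(ε|x−y|)^α(L^jε)^{1−d−α}e^{−δ(L^jε)^{−1}dist({x,y},z)}`. [cite: King1986, Prop 3.7 (3.62), (3.65) p.663, (3.45) p.661]
[cite: Balaban1983Higgs3, (2.10)–(2.11) p.426] -/
theorem entDG_holder_le (hS2 : ∀ μ, 2 < P.sitesPerDir 0 μ) {α δ Cst : ℝ} (hα0 : 0 ≤ α) (hα1 : α ≤ 1) (hδ : 0 ≤ δ) (hCst : 0 ≤ Cst)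
    (h210 : (regTorusKernels S C A msq a k).Ineq210 δ Cst) (h211 : (regTorusKernelsH S C A msq a k).Ineq211At α δ Cst)
    {Asup : ℝ} (hA : ∀ b, |A b| ≤ Asup) (hgauge : (P.d : ℝ) * |C.e| * Asup * P.mesh k ≤ 1)
    {j : ℕ} (hjk : j + 1 ≤ k) (μ : Fin P.d) (i i' : Ix N) {x y : HiggsLattice.Site P 0} (hxy : x ≠ y) (z : HiggsLattice.Site P 0) :
    |entDG C A msq a k j μ i i' x z - entDG C A msq a k j μ i i' y z|
      ≤ 3 * Cst * (P.mesh 0 * (HiggsLattice.Site.tdist x y : ℝ)) ^ α * P.mesh j ^ ((1 : ℝ) - (P.d : ℝ) - α)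
          * Real.exp (-(δ * (P.mesh j)⁻¹ * (P.mesh 0 * min (HiggsLattice.Site.tdist x z : ℝ) (HiggsLattice.Site.tdist y z : ℝ)))) := by
  have hε : 0 < P.mesh 0 := P.mesh_pos 0
  have hs : 0 < P.mesh j := P.mesh_pos j
  have hd1 : (1 : ℝ) ≤ P.d := by exact_mod_cast P.hd
  have hAsup0 : 0 ≤ Asup := (abs_nonneg _).trans (hA ⟨x, ⟨0, P.hd⟩⟩)
  have hεs : P.mesh 0 ≤ P.mesh j := by simpa using mesh_mono P (Nat.zero_le j)
  have hsk : P.mesh j ≤ P.mesh k := mesh_mono P (by omega)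
  have hdeA : (P.d : ℝ) * |C.e| * Asup * P.mesh j ≤ 1 :=
    (mul_le_mul_of_nonneg_left hsk (by positivity)).trans hgauge
  have hsmall : P.mesh 0 * |C.e| * Asup ≤ 1 := by
    have h0 : 0 ≤ |C.e| * Asup := mul_nonneg (abs_nonneg _) hAsup0
    calc P.mesh 0 * |C.e| * Asup = 1 * (|C.e| * Asup * P.mesh 0) := by ring
      _ ≤ (P.d : ℝ) * (|C.e| * Asup * P.mesh j) := mul_le_mul hd1 (mul_le_mul_of_nonneg_left hεs h0) (by positivity) (by positivity)
      _ = (P.d : ℝ) * |C.e| * Asup * P.mesh j := by ring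
      _ ≤ 1 := hdeA
  set r : ℝ := P.mesh 0 * (HiggsLattice.Site.tdist x y : ℝ) with hr
  have hr0 : 0 < r := by
    have h1 : (1 : ℝ) ≤ HiggsLattice.Site.tdist x y := by exact_mod_cast one_le_tdist_of_ne' (Ne.symm hxy)
    rw [hr]; positivity
  set m : ℝ := min (HiggsLattice.Site.tdist x z : ℝ) (HiggsLattice.Site.tdist y z : ℝ) with hm
  set E₂ : ℝ := Real.exp (-(δ * (P.mesh j)⁻¹ * (P.mesh 0 * m))) with hE₂
  have hρ : 0 ≤ δ * (P.mesh j)⁻¹ * P.mesh 0 := by positivity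
  have hEx : Real.exp (-(δ * (P.mesh j)⁻¹ * (P.mesh 0 * (HiggsLattice.Site.tdist x z : ℝ)))) ≤ E₂ := by
    rw [hE₂, Real.exp_le_exp, neg_le_neg_iff, ← mul_assoc, ← mul_assoc]; exact mul_le_mul_of_nonneg_left (min_le_left _ _) hρ
  have hEy : Real.exp (-(δ * (P.mesh j)⁻¹ * (P.mesh 0 * (HiggsLattice.Site.tdist y z : ℝ)))) ≤ E₂ := by
    rw [hE₂, Real.exp_le_exp, neg_le_neg_iff, ← mul_assoc, ← mul_assoc]; exact mul_le_mul_of_nonneg_left (min_le_right _ _) hρ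
  -- sizes of the derivative entries at x and y
  have hDx : |entDG C A msq a k j μ i i' x z| ≤ Cst * P.mesh j ^ ((1 : ℝ) - (P.d : ℝ)) * E₂ := by
    have hb := (h210 j x z).2 μ
    rw [scale_eq, regTorusKernels_dist] at hb
    exact ((abs_entDG_le (S := S) j μ i i' x z).trans hb).trans (mul_le_mul_of_nonneg_left hEx (by positivity))
  have hDy : |entDG C A msq a k j μ i i' y z| ≤ Cst * P.mesh j ^ ((1 : ℝ) - (P.d : ℝ)) * E₂ := by
    have hb := (h210 j y z).2 μ
    rw [scale_eq, regTorusKernels_dist] at hb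
    exact ((abs_entDG_le (S := S) j μ i i' y z).trans hb).trans (mul_le_mul_of_nonneg_left hEy (by positivity))
  rcases le_total r (P.mesh j) with hnear | hfar
  · -- near pairs: transported term (2.11) + defect of the transport along the admissible staircase
    obtain ⟨Γ, hΓ⟩ := exists_isAdm y x
    obtain ⟨hch, hend, hlen⟩ := hΓ
    have h1 := abs_entDG_sub_le (C := C) (A := A) (msq := msq) (a := a) (k := k) j μ i i' x y z Γ
    have h2 := holderTerm_le_holderDiff (S := S) (C := C) (A := A) (msq := msq) (a := a) (k := k) j μ y x z ⟨hch, hend, hlen⟩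
    have h3 := h211 j μ y x z (Ne.symm hxy)
    have hdist : (regTorusKernelsH S C A msq a k).dist y x = r := by
      show P.mesh 0 * (HiggsLattice.Site.tdist y x : ℝ) = _; rw [tdist_comm]
    have hdist2 : (regTorusKernelsH S C A msq a k).dist2 y x z = P.mesh 0 * m := by
      show P.mesh 0 * min (HiggsLattice.Site.tdist y z : ℝ) (HiggsLattice.Site.tdist x z : ℝ) = _; rw [min_comm]
    have hd : ((regTorusKernelsH S C A msq a k).d : ℝ) = P.d := rfl
    rw [scaleH_eq, hdist, hdist2, hd, div_le_iff₀ (Real.rpow_pos_of_pos hr0 _)] at h3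
    -- the defect term
    set ψx := covDeriv C A (pieceA C A msq a k j (cb P N 0 (z, i'))) ⟨x, μ⟩ with hψx
    have hdef := norm_hol_apply_sub_self_le hS2 C A hA hsmall ψx y Γ hch
    have htxy : (HiggsLattice.Site.tdist y x : ℝ) = HiggsLattice.Site.tdist x y := by rw [tdist_comm]
    have hlen' : (Γ.length : ℝ) ≤ (P.d : ℝ) * HiggsLattice.Site.tdist x y := by rw [← htxy]; exact hlen
    have hψ_abs : (P.mesh 0 ^ P.d)⁻¹ * ‖ψx‖ ≤ Cst * P.mesh j ^ ((1 : ℝ) - (P.d : ℝ)) * E₂ := by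
      have hb := (h210 j x z).2 μ
      rw [scale_eq, regTorusKernels_dist, regTorusKernels_absDG] at hb
      have hle : ‖ψx‖ ≤ ∑ i'' : Ix N, ‖covDeriv C A (pieceA C A msq a k j (cb P N 0 (z, i''))) ⟨x, μ⟩‖ :=
        Finset.single_le_sum (f := fun i'' : Ix N => ‖covDeriv C A (pieceA C A msq a k j (cb P N 0 (z, i''))) ⟨x, μ⟩‖)
          (fun _ _ => norm_nonneg _) (Finset.mem_univ i')
      exact ((mul_le_mul_of_nonneg_left hle (inv_nonneg.2 (pow_nonneg hε.le _))).trans hb).trans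
        (mul_le_mul_of_nonneg_left hEx (by positivity))
    have hdef' : (P.mesh 0 ^ P.d)⁻¹ * ‖hol C A y Γ ψx - ψx‖
        ≤ 2 * ((P.d : ℝ) * |C.e| * Asup * r) * (Cst * P.mesh j ^ ((1 : ℝ) - (P.d : ℝ)) * E₂) := by
      have hnn : 0 ≤ 2 * (P.mesh 0 * |C.e| * Asup) * ‖ψx‖ := by positivity
      calc (P.mesh 0 ^ P.d)⁻¹ * ‖hol C A y Γ ψx - ψx‖
          ≤ (P.mesh 0 ^ P.d)⁻¹ * (Γ.length * (2 * (P.mesh 0 * |C.e| * Asup)) * ‖ψx‖) :=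
            mul_le_mul_of_nonneg_left hdef (inv_nonneg.2 (pow_nonneg hε.le _))
        _ ≤ (P.mesh 0 ^ P.d)⁻¹ * ((P.d : ℝ) * HiggsLattice.Site.tdist x y * (2 * (P.mesh 0 * |C.e| * Asup)) * ‖ψx‖) :=
            mul_le_mul_of_nonneg_left (mul_le_mul_of_nonneg_right (mul_le_mul_of_nonneg_right hlen' (by positivity)) (norm_nonneg _))
              (inv_nonneg.2 (pow_nonneg hε.le _))
        _ = 2 * ((P.d : ℝ) * |C.e| * Asup * r) * ((P.mesh 0 ^ P.d)⁻¹ * ‖ψx‖) := by rw [hr]; ring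
        _ ≤ 2 * ((P.d : ℝ) * |C.e| * Asup * r) * (Cst * P.mesh j ^ ((1 : ℝ) - (P.d : ℝ)) * E₂) :=
            mul_le_mul_of_nonneg_left hψ_abs (by positivity)
    -- `(d|e|A_∞ r)·s^{1−d} ≤ r^α s^{1−d−α}` for `r ≤ s` (gauge smallness at scale `L^jε`)
    have hkey : ((P.d : ℝ) * |C.e| * Asup * r) * P.mesh j ^ ((1 : ℝ) - (P.d : ℝ)) ≤ r ^ α * P.mesh j ^ ((1 : ℝ) - (P.d : ℝ) - α) := by
      have h1 : r * P.mesh j ^ ((1 : ℝ) - (P.d : ℝ)) ≤ r ^ α * P.mesh j ^ ((2 : ℝ) - (P.d : ℝ) - α) := by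
        have hrle : r ≤ P.mesh j := hnear
        have e1 : r = r ^ α * r ^ (1 - α) := by rw [← Real.rpow_add hr0]; norm_num
        have e2 : r ^ (1 - α) ≤ P.mesh j ^ (1 - α) := Real.rpow_le_rpow hr0.le hrle (by linarith)
        have e3 : P.mesh j ^ (1 - α) * P.mesh j ^ ((1 : ℝ) - (P.d : ℝ)) = P.mesh j ^ ((2 : ℝ) - (P.d : ℝ) - α) := by
          rw [← Real.rpow_add hs]; congr 1; ring
        calc r * P.mesh j ^ ((1 : ℝ) - (P.d : ℝ)) = r ^ α * (r ^ (1 - α) * P.mesh j ^ ((1 : ℝ) - (P.d : ℝ))) := by rw [← mul_assoc, ← e1]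
          _ ≤ r ^ α * (P.mesh j ^ (1 - α) * P.mesh j ^ ((1 : ℝ) - (P.d : ℝ))) :=
              mul_le_mul_of_nonneg_left (mul_le_mul_of_nonneg_right e2 (Real.rpow_nonneg hs.le _)) (Real.rpow_nonneg hr0.le _)
          _ = r ^ α * P.mesh j ^ ((2 : ℝ) - (P.d : ℝ) - α) := by rw [e3]
      have e4 : P.mesh j ^ ((2 : ℝ) - (P.d : ℝ) - α) = P.mesh j * P.mesh j ^ ((1 : ℝ) - (P.d : ℝ) - α) := by
        rw [show (2 : ℝ) - (P.d : ℝ) - α = 1 + ((1 : ℝ) - (P.d : ℝ) - α) by ring, Real.rpow_add hs, Real.rpow_one]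
      have hc0 : 0 ≤ (P.d : ℝ) * |C.e| * Asup := by positivity
      calc ((P.d : ℝ) * |C.e| * Asup * r) * P.mesh j ^ ((1 : ℝ) - (P.d : ℝ))
          = ((P.d : ℝ) * |C.e| * Asup) * (r * P.mesh j ^ ((1 : ℝ) - (P.d : ℝ))) := by ring
        _ ≤ ((P.d : ℝ) * |C.e| * Asup) * (r ^ α * P.mesh j ^ ((2 : ℝ) - (P.d : ℝ) - α)) := mul_le_mul_of_nonneg_left h1 hc0
        _ = ((P.d : ℝ) * |C.e| * Asup * P.mesh j) * (r ^ α * P.mesh j ^ ((1 : ℝ) - (P.d : ℝ) - α)) := by rw [e4]; ring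
        _ ≤ 1 * (r ^ α * P.mesh j ^ ((1 : ℝ) - (P.d : ℝ) - α)) :=
            mul_le_mul_of_nonneg_right hdeA (mul_nonneg (Real.rpow_nonneg hr0.le _) (Real.rpow_nonneg hs.le _))
        _ = r ^ α * P.mesh j ^ ((1 : ℝ) - (P.d : ℝ) - α) := one_mul _
    have hE0 : 0 ≤ E₂ := Real.exp_nonneg _
    have hT1 : holderTerm C A msq a k j μ y x z Γ ≤ Cst * P.mesh j ^ ((1 : ℝ) - (P.d : ℝ) - α) * E₂ * r ^ α := h2.trans h3
    have hT2 : (P.mesh 0 ^ P.d)⁻¹ * ‖hol C A y Γ ψx - ψx‖ ≤ 2 * Cst * (r ^ α * P.mesh j ^ ((1 : ℝ) - (P.d : ℝ) - α)) * E₂ := by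
      refine hdef'.trans ?_
      have : 2 * ((P.d : ℝ) * |C.e| * Asup * r) * (Cst * P.mesh j ^ ((1 : ℝ) - (P.d : ℝ)) * E₂)
          = 2 * Cst * ((((P.d : ℝ) * |C.e| * Asup * r)) * P.mesh j ^ ((1 : ℝ) - (P.d : ℝ))) * E₂ := by ring
      rw [this]
      exact mul_le_mul_of_nonneg_right (mul_le_mul_of_nonneg_left hkey (by positivity)) hE0
    calc |entDG C A msq a k j μ i i' x z - entDG C A msq a k j μ i i' y z|
        ≤ holderTerm C A msq a k j μ y x z Γ + (P.mesh 0 ^ P.d)⁻¹ * ‖hol C A y Γ ψx - ψx‖ := h1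
      _ ≤ Cst * P.mesh j ^ ((1 : ℝ) - (P.d : ℝ) - α) * E₂ * r ^ α + 2 * Cst * (r ^ α * P.mesh j ^ ((1 : ℝ) - (P.d : ℝ) - α)) * E₂ :=
          add_le_add hT1 hT2
      _ = _ := by ring
  · -- far pairs: sizes
    have hsize : P.mesh j ^ ((1 : ℝ) - (P.d : ℝ)) ≤ r ^ α * P.mesh j ^ ((1 : ℝ) - (P.d : ℝ) - α) := by
      have h1 : P.mesh j ^ ((1 : ℝ) - (P.d : ℝ)) = P.mesh j ^ α * P.mesh j ^ ((1 : ℝ) - (P.d : ℝ) - α) := by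
        rw [← Real.rpow_add hs]; congr 1; ring
      rw [h1]
      exact mul_le_mul_of_nonneg_right (Real.rpow_le_rpow hs.le hfar hα0) (Real.rpow_nonneg hs.le _)
    calc |entDG C A msq a k j μ i i' x z - entDG C A msq a k j μ i i' y z|
        ≤ |entDG C A msq a k j μ i i' x z| + |entDG C A msq a k j μ i i' y z| := abs_sub _ _
      _ ≤ 2 * Cst * P.mesh j ^ ((1 : ℝ) - (P.d : ℝ)) * E₂ := by linarith [hDx, hDy]
      _ ≤ 2 * Cst * (r ^ α * P.mesh j ^ ((1 : ℝ) - (P.d : ℝ) - α)) * E₂ :=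
          mul_le_mul_of_nonneg_right (mul_le_mul_of_nonneg_left hsize (by positivity)) (Real.exp_nonneg _)
      _ ≤ 3 * Cst * (r ^ α * P.mesh j ^ ((1 : ℝ) - (P.d : ℝ) - α)) * E₂ := by
          have : 0 ≤ Cst * (r ^ α * P.mesh j ^ ((1 : ℝ) - (P.d : ℝ) - α)) * E₂ := by positivity
          linarith
      _ = _ := by ring

end Torus

end Summit.QuantumFields.YangMills.BalabanUVNodes.N15KingModelRung.RegularField

end
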